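import Mathlib
import Literature.Analysis.FluidPDE.VectorCalculus
import Literature.Analysis.FluidPDE.AxisymmetricEuler
import Literature.Analysis.FluidPDE.WholeSpaceIBP
import Literature.Analysis.FluidPDE.AxisymHouLiVariables
import Summits.NavierStokesRegularity.NavierStokesRegularity.Theorems.ThreadingFluxHorizonTowerDefs
import HarnessLib

/-!
# Crux `PoloidalLiouville` (stmt-NavierStokesRegularity-1222, W1), crux idea «silent-shells» (ns-idea-15 g8):
# tools for the UNCONDITIONAL Jiu–Xin compact Liouville theorem (O1)

The silent-shells card kills the multi-axis compacton by obstruction (O1): *a compactly supported `C¹` steady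
axisymmetric Euler flow WITHOUT swirl vanishes* (Jiu–Xin, CMP 287 (2009), Thm 5.3, compact-support corollary;
sketch `Cruxes/PoloidalLiouville/SilentShellsSketch.lean` v1.4 l.268 `jiuXin_noSwirl_liouville`, there a Prop-hypothesis).
This file and its sequel `ThreadingFluxSilentShellsJiuXinLiouville` PROVE it in the kernel.  Here: the calculus.

* `JiuXin.pressure_const_outside` — the pressure of a compactly supported steady Euler pair is constant outside a ball
  (`∇P = −(U·∇)U = 0` off `tsupport U`; the exterior of a ball in `ℝ³` is preconnected).
* `JiuXin.virial_identity` — the GENERALISED VIRIAL IDENTITY `∫ ⟪U, DG[U]⟫ = −∫ (P − p₀) div G` for EVERY `C¹`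
  vector field `G` (two whole-space integrations by parts, tree `integral_mul_divergence_add_eq_zero_left`).
* the Jiu–Xin test field `JiuXin.testField ε x = x_h / (ρ² + ε²)` (`x_h = (x₀, x₁, 0)`, `ρ² = x₀² + x₁²`), a smooth
  regularisation of the axis-singular harmonic field `∇ log ρ = x_h/ρ²` of [JiuXin2008, (3.22)]: its derivative,
  `⟪v, DG_ε(x) v⟫ = |v_h|²/(ρ²+ε²) − 2⟪x_h, v_h⟫²/(ρ²+ε²)²`, and `div G_ε = 2ε²/(ρ²+ε²)²`;
* the no-swirl Lagrange identity `⟪x_h, U_h⟫² = ρ² |U_h|²` and the axis bound `|U_h(x)|² ≤ M² ρ²` for an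
  axisymmetric `C¹` field with `‖DU‖ ≤ M`.

All `--supports stmt-NavierStokesRegularity-1222 --as helper`; W1 movement 0; NS regularity is NOT proved by any of this.
References: Q. Jiu, Z. Xin, *Smooth approximations and exact solutions of the 3D steady axisymmetric Euler equations*,
Comm. Math. Phys. 287 (2009) 323–350, Thm 5.3 and (3.22)–(3.28).
-/

-- the summit and its single problem share the name (D-0017 nested layout)
set_option linter.dupNamespace false

noncomputable section

namespace Summit.NavierStokesRegularity.NavierStokesRegularity.Theorems.PoloidalLiouville.SilentShells

open Set Function Filter MeasureTheory Topology Metric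
open scoped Topology RealInnerProductSpace
open Literature.Analysis.FluidPDE
open Summit.NavierStokesRegularity.NavierStokesRegularity.Theorems.PoloidalLiouville.HorizonTower (E3)

namespace JiuXin

/-! ## Coordinates on `ℝ³` -/

/-! (Coordinates `x ↦ xᵢ` are the continuous linear maps `EuclideanSpace.proj i`; used inline.) -/

/-- The horizontal projection `x ↦ x_h = (x₀, x₁, 0)` as a continuous linear map. -/
def hor : E3 →L[ℝ] E3 :=
  (EuclideanSpace.proj (0 : Fin 3) : E3 →L[ℝ] ℝ).smulRight (EuclideanSpace.single 0 (1 : ℝ)) +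
    (EuclideanSpace.proj (1 : Fin 3) : E3 →L[ℝ] ℝ).smulRight (EuclideanSpace.single 1 (1 : ℝ))

/-- `(x_h)₀ = x₀`. -/
@[simp] theorem hor_apply_zero (x : E3) : hor x 0 = x 0 := by
  simp [hor]

/-- `(x_h)₁ = x₁`. -/
@[simp] theorem hor_apply_one (x : E3) : hor x 1 = x 1 := by
  simp [hor]

/-- `(x_h)₂ = 0`. -/
@[simp] theorem hor_apply_two (x : E3) : hor x 2 = 0 := by
  simp [hor]

/-- `⟪v, w_h⟫ = v₀ w₀ + v₁ w₁`. -/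
theorem inner_hor (v w : E3) : ⟪v, hor w⟫ = v 0 * w 0 + v 1 * w 1 := by
  simp only [PiLp.inner_apply, Fin.sum_univ_three, RCLike.inner_apply, conj_trivial, hor_apply_zero,
    hor_apply_one, hor_apply_two]
  ring

/-- The squared cylindrical radius `ρ² = x₀² + x₁²` (written with products, as the product rule delivers it). -/
def cylSq (x : E3) : ℝ := x 0 * x 0 + x 1 * x 1

/-- `ρ² ≥ 0`. -/
theorem cylSq_nonneg (x : E3) : 0 ≤ cylSq x := by
  unfold cylSq; nlinarith [mul_self_nonneg (x 0), mul_self_nonneg (x 1)]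

/-- `ρ² = ⟪x, x_h⟫`. -/
theorem cylSq_eq_inner_hor (x : E3) : cylSq x = ⟪x, hor x⟫ := by
  rw [inner_hor]; rfl

/-- `‖x_h‖² = ρ²`. -/
theorem norm_hor_sq (x : E3) : ‖hor x‖ ^ 2 = cylSq x := by
  rw [← real_inner_self_eq_norm_sq, inner_hor]; simp [cylSq]

/-- On the axis (`ρ² = 0`) both horizontal coordinates vanish. -/
theorem coord_eq_zero_of_cylSq_eq_zero {x : E3} (hx : cylSq x = 0) : x 0 = 0 ∧ x 1 = 0 := by
  unfold cylSq at hx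
  constructor <;> nlinarith [mul_self_nonneg (x 0), mul_self_nonneg (x 1)]

/-- The derivative of `ρ²`: `D(ρ²)(x) v = 2 (x₀ v₀ + x₁ v₁)`. -/
def cylSq' (x : E3) : E3 →L[ℝ] ℝ :=
  (x 0 • (EuclideanSpace.proj (0 : Fin 3) : E3 →L[ℝ] ℝ) + x 0 • (EuclideanSpace.proj (0 : Fin 3) : E3 →L[ℝ] ℝ)) +
    (x 1 • (EuclideanSpace.proj (1 : Fin 3) : E3 →L[ℝ] ℝ) + x 1 • (EuclideanSpace.proj (1 : Fin 3) : E3 →L[ℝ] ℝ))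

/-- `D(ρ²)(x) v = 2(x₀v₀ + x₁v₁)`. -/
theorem cylSq'_apply (x v : E3) : cylSq' x v = 2 * (x 0 * v 0 + x 1 * v 1) := by
  simp [cylSq']; ring

/-- `ρ²` has derivative `cylSq' x`. -/
theorem hasFDerivAt_cylSq (x : E3) : HasFDerivAt cylSq (cylSq' x) x :=
  (((EuclideanSpace.proj (0 : Fin 3) : E3 →L[ℝ] ℝ).hasFDerivAt.mul
    (EuclideanSpace.proj (0 : Fin 3) : E3 →L[ℝ] ℝ).hasFDerivAt).add
    ((EuclideanSpace.proj (1 : Fin 3) : E3 →L[ℝ] ℝ).hasFDerivAt.mul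
      (EuclideanSpace.proj (1 : Fin 3) : E3 →L[ℝ] ℝ).hasFDerivAt))

/-- `ρ²` is smooth. -/
theorem contDiff_cylSq {n : WithTop ℕ∞} : ContDiff ℝ n cylSq :=
  (((EuclideanSpace.proj (0 : Fin 3) : E3 →L[ℝ] ℝ).contDiff.mul
    (EuclideanSpace.proj (0 : Fin 3) : E3 →L[ℝ] ℝ).contDiff)).add
    (((EuclideanSpace.proj (1 : Fin 3) : E3 →L[ℝ] ℝ).contDiff.mul
      (EuclideanSpace.proj (1 : Fin 3) : E3 →L[ℝ] ℝ).contDiff))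

/-- `ρ²` is continuous. -/
theorem continuous_cylSq : Continuous cylSq := contDiff_cylSq (n := 0) |>.continuous

/-- The axis point below/above `x`: `x − x_h = (0, 0, x₂)`. -/
theorem sub_hor_apply (x : E3) : (x - hor x) 0 = 0 ∧ (x - hor x) 1 = 0 ∧ (x - hor x) 2 = x 2 := by
  refine ⟨?_, ?_, ?_⟩ <;> simp

/-! ## The Jiu–Xin test field `G_ε = x_h / (ρ² + ε²)` -/

/-- The regularised Jiu–Xin test field `G_ε(x) = x_h / (ρ² + ε²)` (for `ε → 0` it tends to `∇ log ρ`). -/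
def testField (ε : ℝ) (x : E3) : E3 := (cylSq x + ε ^ 2)⁻¹ • hor x

/-- `ρ² + ε² > 0` for `ε ≠ 0`. -/
theorem cylSq_add_sq_pos {ε : ℝ} (hε : ε ≠ 0) (x : E3) : 0 < cylSq x + ε ^ 2 :=
  add_pos_of_nonneg_of_pos (cylSq_nonneg x) (by positivity)

/-- The derivative of `G_ε`: `DG_ε(x) v = v_h/(ρ²+ε²) − 2⟪x_h,v⟫ x_h/(ρ²+ε²)²`. -/
def testField' (ε : ℝ) (x : E3) : E3 →L[ℝ] E3 :=
  (cylSq x + ε ^ 2)⁻¹ • hor + ((-((cylSq x + ε ^ 2) ^ 2)⁻¹) • cylSq' x).smulRight (hor x)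

/-- `G_ε` has derivative `testField' ε x` at every point (`ε ≠ 0`). -/
theorem hasFDerivAt_testField {ε : ℝ} (hε : ε ≠ 0) (x : E3) :
    HasFDerivAt (testField ε) (testField' ε x) x := by
  have h1 : HasFDerivAt (fun y => cylSq y + ε ^ 2) (cylSq' x) x := by
    simpa using (hasFDerivAt_cylSq x).add_const (ε ^ 2)
  have h2 : HasFDerivAt (fun y => (cylSq y + ε ^ 2)⁻¹) ((-((cylSq x + ε ^ 2) ^ 2)⁻¹) • cylSq' x) x :=
    (hasDerivAt_inv (cylSq_add_sq_pos hε x).ne').comp_hasFDerivAt x h1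
  have h3 : HasFDerivAt (fun y : E3 => hor y) hor x := hor.hasFDerivAt
  exact h2.smul h3

/-- `fderiv` form of `hasFDerivAt_testField`. -/
theorem fderiv_testField {ε : ℝ} (hε : ε ≠ 0) (x : E3) :
    fderiv ℝ (testField ε) x = testField' ε x :=
  (hasFDerivAt_testField hε x).fderiv

/-- `DG_ε(x) v` evaluated. -/
theorem testField'_apply (ε : ℝ) (x v : E3) :
    testField' ε x v = (cylSq x + ε ^ 2)⁻¹ • hor v +
      (-((cylSq x + ε ^ 2) ^ 2)⁻¹ * (2 * (x 0 * v 0 + x 1 * v 1))) • hor x := by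
  simp [testField', cylSq'_apply, ContinuousLinearMap.smulRight_apply]

/-- `G_ε` is smooth for `ε ≠ 0`. -/
theorem contDiff_testField {n : WithTop ℕ∞} {ε : ℝ} (hε : ε ≠ 0) : ContDiff ℝ n (testField ε) := by
  unfold testField
  exact ((contDiff_cylSq.add contDiff_const).inv fun x => (cylSq_add_sq_pos hε x).ne').smul
    hor.contDiff

/-- `G_ε` is continuous for `ε ≠ 0`. -/
theorem continuous_testField {ε : ℝ} (hε : ε ≠ 0) : Continuous (testField ε) :=
  (contDiff_testField (n := 0) hε).continuous

/-- **The quadratic form of `DG_ε`**: `⟪v, DG_ε(x) v⟫ = |v_h|²/(ρ²+ε²) − 2 ⟪x_h, v_h⟫²/(ρ²+ε²)²`. -/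
theorem inner_fderiv_testField {ε : ℝ} (hε : ε ≠ 0) (x v : E3) :
    ⟪v, fderiv ℝ (testField ε) x v⟫ =
      (v 0 * v 0 + v 1 * v 1) / (cylSq x + ε ^ 2) -
        2 * (x 0 * v 0 + x 1 * v 1) ^ 2 / (cylSq x + ε ^ 2) ^ 2 := by
  rw [fderiv_testField hε, testField'_apply, inner_add_right, inner_smul_right, inner_smul_right,
    inner_hor, inner_hor]
  ring

/-- **The divergence of `G_ε`**: `div G_ε = 2ε²/(ρ²+ε²)²` — an approximate identity along the axis. -/
theorem divergence_testField {ε : ℝ} (hε : ε ≠ 0) (x : E3) :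
    VectorCalculus.divergence (testField ε) x = 2 * ε ^ 2 / (cylSq x + ε ^ 2) ^ 2 := by
  have hq : cylSq x + ε ^ 2 ≠ 0 := (cylSq_add_sq_pos hε x).ne'
  rw [divergence_eq_sum_inner_fderiv (EuclideanSpace.basisFun (Fin 3) ℝ), fderiv_testField hε]
  simp only [Fin.sum_univ_three, EuclideanSpace.basisFun_apply, testField'_apply, inner_add_right,
    inner_smul_right, EuclideanSpace.inner_single_left, hor_apply_zero, hor_apply_one, hor_apply_two,
    PiLp.single_apply]
  simp only [Real.ringHom_apply, ↓reduceIte, mul_one, Fin.isValue, one_ne_zero, mul_zero, add_zero, neg_mul,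
    one_mul, zero_ne_one, zero_add, Fin.reduceEq]
  unfold cylSq
  field_simp
  ring

/-- `div G_ε ≥ 0`. -/
theorem divergence_testField_nonneg {ε : ℝ} (hε : ε ≠ 0) (x : E3) :
    0 ≤ VectorCalculus.divergence (testField ε) x := by
  rw [divergence_testField hε]; positivity

/-- `⟪x, G_ε x⟫ = ρ²/(ρ²+ε²) ∈ [0, 1]`. -/
theorem inner_self_testField {ε : ℝ} (x : E3) :
    ⟪x, testField ε x⟫ = cylSq x / (cylSq x + ε ^ 2) := by
  rw [testField, inner_smul_right, ← cylSq_eq_inner_hor, div_eq_inv_mul]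

/-- `|⟪x, G_ε x⟫| ≤ 1`. -/
theorem abs_inner_self_testField_le_one {ε : ℝ} (hε : ε ≠ 0) (x : E3) :
    |⟪x, testField ε x⟫| ≤ 1 := by
  rw [inner_self_testField, abs_of_nonneg (div_nonneg (cylSq_nonneg x) (cylSq_add_sq_pos hε x).le)]
  exact div_le_one_of_le₀ (by nlinarith [sq_nonneg ε]) (cylSq_add_sq_pos hε x).le

/-! ## No swirl: the Lagrange identity -/

/-- For a field WITHOUT SWIRL (`x₀ U₁ − x₁ U₀ = 0`), `⟪x_h, U_h⟫² = ρ² |U_h|²` (Lagrange's identity). -/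
theorem sq_inner_hor_of_swirl_eq_zero {U : E3 → E3} {x : E3} (h : swirl U x = 0) :
    (x 0 * U x 0 + x 1 * U x 1) ^ 2 = cylSq x * (U x 0 * U x 0 + U x 1 * U x 1) := by
  unfold swirl at h
  unfold cylSq
  linear_combination (-(x 0 * U x 1 - x 1 * U x 0)) * h

/-- The Jiu–Xin integrand: without swirl, `⟪U, DG_ε[U]⟫ = |U_h|² (ε² − ρ²)/(ρ²+ε²)²`. -/
theorem inner_fderiv_testField_of_swirl_eq_zero {ε : ℝ} (hε : ε ≠ 0) {U : E3 → E3} {x : E3}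
    (h : swirl U x = 0) :
    ⟪U x, fderiv ℝ (testField ε) x (U x)⟫ =
      (U x 0 * U x 0 + U x 1 * U x 1) * ((ε ^ 2 - cylSq x) / (cylSq x + ε ^ 2) ^ 2) := by
  have hq : cylSq x + ε ^ 2 ≠ 0 := (cylSq_add_sq_pos hε x).ne'
  rw [inner_fderiv_testField hε, sq_inner_hor_of_swirl_eq_zero h]
  field_simp
  ring


/-! ## Steady Euler pairs with compact support: pressure at infinity and the generalised virial identity -/

section Euler

variable {U : E3 → E3} {P : E3 → ℝ}

/-- The exterior of a closed ball in `ℝ³` is preconnected (continuous image of `sphere × (R, ∞)`).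
(Adapted from the crux sketch `SilentShellsSketch.isPreconnected_compl_closedBall_r3`.) -/
theorem isPreconnected_compl_closedBall {R : ℝ} (hR : 0 ≤ R) :
    IsPreconnected (Metric.closedBall (0 : E3) R)ᶜ := by
  have hE : 1 < Module.rank ℝ E3 := by
    rw [← Module.finrank_eq_rank]
    norm_cast
    simp [finrank_euclideanSpace]
  have himage : (fun q : E3 × ℝ => q.2 • q.1) '' (Metric.sphere (0 : E3) 1 ×ˢ Ioi R) =
      (Metric.closedBall (0 : E3) R)ᶜ := by
    ext z
    rw [mem_compl_iff, Metric.mem_closedBall, dist_zero_right, not_le]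
    constructor
    · rintro ⟨⟨y, t⟩, ⟨hy, ht⟩, rfl⟩
      rw [mem_sphere_zero_iff_norm] at hy
      change R < t at ht
      show R < ‖t • y‖
      rw [norm_smul, hy, mul_one, Real.norm_of_nonneg (hR.trans ht.le)]
      exact ht
    · intro hz
      have hn : ‖z‖ ≠ 0 := (hR.trans_lt hz).ne'
      refine ⟨(‖z‖⁻¹ • z, ‖z‖), ⟨?_, hz⟩, ?_⟩
      · show ‖z‖⁻¹ • z ∈ Metric.sphere (0 : E3) 1
        rw [mem_sphere_zero_iff_norm, norm_smul, norm_inv, norm_norm, inv_mul_cancel₀ hn]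
      · show ‖z‖ • ‖z‖⁻¹ • z = z
        rw [smul_smul, mul_inv_cancel₀ hn, one_smul]
  rw [← himage]
  exact ((isPreconnected_sphere hE 0 1).prod isPreconnected_Ioi).image _
    (continuous_snd.smul continuous_fst).continuousOn

/-- **Pressure at infinity.** For a `C¹` steady Euler pair `(U·∇)U + ∇P = 0` with `U` compactly supported there are
`R ≥ 1` and `p₀` with `tsupport U ⊆ B̄(0,R)` and `P ≡ p₀` off `B̄(0,R)`: `∇P = −(U·∇)U` vanishes off the support and the
exterior of a ball is connected.  (Adapted from the crux sketch `SilentShellsSketch.pressure_const_outside`.) -/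
theorem pressure_const_outside (hP : ContDiff ℝ 1 P) (hE : ∀ x, convect U U x + gradient P x = 0)
    (hc : HasCompactSupport U) :
    ∃ R : ℝ, 1 ≤ R ∧ tsupport U ⊆ Metric.closedBall 0 R ∧
      ∃ p₀ : ℝ, ∀ x, x ∉ Metric.closedBall (0 : E3) R → P x = p₀ := by
  obtain ⟨R, hR⟩ := (hc : IsCompact (tsupport U)).isBounded.subset_closedBall (0 : E3)
  refine ⟨max R 1, le_max_right _ _, hR.trans (Metric.closedBall_subset_closedBall (le_max_left _ _)), ?_⟩
  have h0 : (0 : ℝ) ≤ max R 1 := zero_le_one.trans (le_max_right _ _)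
  have hopen : IsOpen (Metric.closedBall (0 : E3) (max R 1))ᶜ := Metric.isClosed_closedBall.isOpen_compl
  have hdiff : DifferentiableOn ℝ P (Metric.closedBall (0 : E3) (max R 1))ᶜ :=
    (hP.differentiable one_ne_zero).differentiableOn
  have hzero : (Metric.closedBall (0 : E3) (max R 1))ᶜ.EqOn (fderiv ℝ P) 0 := by
    intro x hx
    have hxU : x ∉ tsupport U := fun hx' =>
      hx (Metric.closedBall_subset_closedBall (le_max_left _ _) (hR hx'))
    have hUx : U x = 0 := image_eq_zero_of_notMem_tsupport hxU
    have hg : gradient P x = 0 := by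
      have := hE x
      simpa [convect, hUx] using this
    have : fderiv ℝ P x = (InnerProductSpace.toDual ℝ E3) (gradient P x) := by
      simp [gradient]
    rw [Pi.zero_apply, this, hg, map_zero]
  obtain ⟨p₀, hp₀⟩ := hopen.exists_is_const_of_fderiv_eq_zero (isPreconnected_compl_closedBall h0) hdiff hzero
  exact ⟨p₀, fun x hx => hp₀ x hx⟩

/-- `P − p₀` has compact support when `P ≡ p₀` off a closed ball. -/
theorem hasCompactSupport_sub_const {R p₀ : ℝ} (hp : ∀ x, x ∉ Metric.closedBall (0 : E3) R → P x = p₀) :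
    HasCompactSupport (fun x => P x - p₀) :=
  HasCompactSupport.intro (isCompact_closedBall (0 : E3) R) fun x hx => by simp [hp x hx]

/-- **Generalised virial identity.** For a `C¹` steady Euler pair `(U, P)` with `div U = 0`, `U` compactly supported
and `P ≡ p₀` off a ball, and for EVERY `C¹` vector field `G`,
`∫ ⟪U, DG[U]⟫ = −∫ (P − p₀) div G`.
(`G = x` is the classical virial identity `∫ |U|² + 3(P − p₀) = 0`; the Jiu–Xin field `G_ε` gives the identity below.)
Proof: `θ = ⟪U, G⟫ ∈ C¹_c` against the divergence-free `U` gives `∫ ⟪(U·∇)U, G⟫ + ∫ ⟪U, DG[U]⟫ = 0`; the Euler equation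
turns the first term into `−∫ ⟪∇P, G⟫ = −∫ ⟪∇(P − p₀), G⟫ = ∫ (P − p₀) div G` (whole-space integration by parts, tree
`integral_mul_divergence_add_eq_zero_left`). [cite: JiuXin2008, (3.22)–(3.24)] -/
theorem virial_identity (hU : ContDiff ℝ 1 U) (hP : ContDiff ℝ 1 P) (hdiv : VectorCalculus.IsDivFree U)
    (hE : ∀ x, convect U U x + gradient P x = 0) (hc : HasCompactSupport U) {R p₀ : ℝ}
    (hp : ∀ x, x ∉ Metric.closedBall (0 : E3) R → P x = p₀) {G : E3 → E3} (hG : ContDiff ℝ 1 G) :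
    ∫ x, ⟪U x, fderiv ℝ G x (U x)⟫ = -∫ x, (P x - p₀) * VectorCalculus.divergence G x := by
  -- (1) test `θ = ⟪U, G⟫` against `U`
  have hθ : ContDiff ℝ 1 fun x => ⟪U x, G x⟫ := hU.inner ℝ hG
  have hθc : HasCompactSupport fun x => ⟪U x, G x⟫ :=
    hc.mono fun x hx => by contrapose! hx; simp_all
  have h1 := integral_mul_divergence_add_eq_zero_left hθ hU hθc
  have hz : ∫ x, ⟪U x, G x⟫ * VectorCalculus.divergence U x = 0 := by
    simp [hdiv _]
  rw [hz, zero_add] at h1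
  have hUd : ∀ x, DifferentiableAt ℝ U x := fun x => hU.differentiable one_ne_zero x
  have hGd : ∀ x, DifferentiableAt ℝ G x := fun x => hG.differentiable one_ne_zero x
  have hgrad : ∀ x, ⟪U x, gradient (fun y => ⟪U y, G y⟫) x⟫ =
      ⟪U x, fderiv ℝ G x (U x)⟫ - ⟪gradient P x, G x⟫ := by
    intro x
    rw [gradient, real_inner_comm, InnerProductSpace.toDual_symm_apply, fderiv_inner_apply ℝ (hUd x) (hGd x)]
    have hconv : fderiv ℝ U x (U x) = -gradient P x := by
      have := hE x; rw [convect_apply] at this; exact eq_neg_of_add_eq_zero_left this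
    simp [hconv, inner_neg_left, sub_eq_add_neg]
  simp_rw [hgrad] at h1
  have hi₁ : Integrable (fun x => ⟪U x, fderiv ℝ G x (U x)⟫) (volume : Measure E3) :=
    (hU.continuous.inner ((hG.continuous_fderiv one_ne_zero).clm_apply hU.continuous))
      |>.integrable_of_hasCompactSupport (hc.mono fun x hx => by contrapose! hx; simp_all)
  have hPc : HasCompactSupport fun x => P x - p₀ := hasCompactSupport_sub_const hp
  have hgradP : ∀ x, gradient P x = gradient (fun y => P y - p₀) x := fun x => by
    simp [gradient, fderiv_sub_const]
  have hgc : HasCompactSupport (gradient P) := by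
    rw [show gradient P = gradient (fun y => P y - p₀) from funext hgradP]
    exact hPc.fderiv (𝕜 := ℝ) |>.comp_left (map_zero _)
  have hi₂ : Integrable (fun x => ⟪gradient P x, G x⟫) (volume : Measure E3) :=
    ((continuous_gradient_of_contDiff hP).inner hG.continuous).integrable_of_hasCompactSupport
      (hgc.mono fun x hx => by
        rw [Function.mem_support] at hx ⊢
        contrapose! hx
        simp [hx])
  rw [integral_sub hi₁ hi₂, sub_eq_zero] at h1
  -- (2) test `θ = P − p₀` against `G`
  have h2 := integral_mul_divergence_add_eq_zero_left (hP.sub contDiff_const) hG hPc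
  have h2' : ∫ x, ⟪gradient P x, G x⟫ = -∫ x, (P x - p₀) * VectorCalculus.divergence G x := by
    have : ∫ x, ⟪G x, gradient (fun y => P y - p₀) x⟫ = ∫ x, ⟪gradient P x, G x⟫ :=
      integral_congr_ae (Eventually.of_forall fun x => by beta_reduce; rw [← hgradP x, real_inner_comm])
    linarith
  rw [h1, h2']

end Euler

/-! ## Axisymmetric fields near the axis -/

/-- For an axisymmetric differentiable field the horizontal velocity vanishes on the axis, so `U_h(x)` is the
horizontal part of `U(x) − U(x − x_h)`; with `‖DU‖ ≤ M` everywhere the mean value inequality gives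
`|U_h(x)|² ≤ M² ρ²`. -/
theorem horSq_le_of_isAxisymmetric {U : E3 → E3} (hax : IsAxisymmetric U) (hU : Differentiable ℝ U) {M : ℝ}
    (hM : ∀ x, ‖fderiv ℝ U x‖ ≤ M) (x : E3) :
    U x 0 * U x 0 + U x 1 * U x 1 ≤ M ^ 2 * cylSq x := by
  set a : E3 := x - hor x with ha
  have ha0 : a 0 = 0 := (sub_hor_apply x).1
  have ha1 : a 1 = 0 := (sub_hor_apply x).2.1
  have hUa0 : U a 0 = 0 := hax.apply_zero_eq_zero_of_axis hU ha0 ha1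
  have hUa1 : U a 1 = 0 := hax.apply_one_eq_zero_of_axis hU ha0 ha1
  have hmv : ‖U x - U a‖ ≤ M * ‖x - a‖ :=
    (convex_univ).norm_image_sub_le_of_norm_fderiv_le (fun y _ => hU y) (fun y _ => hM y)
      (mem_univ a) (mem_univ x)
  have hxa : ‖x - a‖ ^ 2 = cylSq x := by
    rw [ha, sub_sub_cancel, norm_hor_sq]
  have hM0 : 0 ≤ M := (norm_nonneg _).trans (hM 0)
  have hsq : ‖U x - U a‖ ^ 2 ≤ M ^ 2 * cylSq x := by
    rw [← hxa, ← mul_pow]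
    exact pow_le_pow_left₀ (norm_nonneg _) hmv 2
  have hcomp : U x 0 * U x 0 + U x 1 * U x 1 ≤ ‖U x - U a‖ ^ 2 := by
    rw [← real_inner_self_eq_norm_sq]
    simp only [PiLp.inner_apply, Fin.sum_univ_three, RCLike.inner_apply, conj_trivial, PiLp.sub_apply, hUa0,
      hUa1, sub_zero]
    nlinarith [mul_self_nonneg (U x 2 - U a 2)]
  exact hcomp.trans hsq

/-- On the axis an axisymmetric differentiable field is axial: `U(a) = U₂(a) e₂`. -/
theorem apply_axis_eq_smul {U : E3 → E3} (hax : IsAxisymmetric U) (hU : Differentiable ℝ U) {a : E3}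
    (ha0 : a 0 = 0) (ha1 : a 1 = 0) : U a = (U a 2) • EuclideanSpace.single 2 (1 : ℝ) := by
  ext i
  fin_cases i
  · simpa using hax.apply_zero_eq_zero_of_axis hU ha0 ha1
  · simpa using hax.apply_one_eq_zero_of_axis hU ha0 ha1
  · simp

end JiuXin

end Summit.NavierStokesRegularity.NavierStokesRegularity.Theorems.PoloidalLiouville.SilentShells

end
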